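import Summits.HodgeConjecture.HodgeConjecture.Theses.EndoscopicMiddleDegree

/-!
# Line `lefschetz-one-rank-down` — skeleton for crux `EndoscopicMiddleDegree.MiddleThetaSpan`
(item stmt-HodgeConjecture-13661, route route-HodgeConjecture-EndoscopicMiddleDegree; crux-plan round 1,
idea card `Cruxes/MiddleThetaSpan/Ideas/lefschetz-one-rank-down.md`, triage r1-1: **pass**, narrowed to
`3+1+1`-type `Ψ₃`-cores; planner-cruxplan-stmt-HodgeConjecture-13661-lefschetz-one-rank-d-0, 2026-08-16)

## The line in one paragraph

On a compact arithmetic quotient `X = Γ \ 𝔹^{2n}` (`n = m+1 ∈ {2,3}`) decompose `H^{2n}(X(ℂ); ℂ)` under the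
rational Hecke algebra into its `ℚ`-isotypic pieces `N = W([π_f])^Γ ⊗ ℂ` (Matsushima, BMM Thm 61). A rational
Hodge `(n,n)`-class `c` is the sum of its components, each a rational Hodge class in one piece (Hecke
idempotents are rational morphisms of Hodge structures). Read the pieces by their HODGE NUMBERS:
* TATE-SHAPED pieces (made of Hodge classes = Tate-type singleton packets `Ψ' ⊞ χ₀`, `χ₀` parallel) are in the
  theta span — the theta half, sibling lines (`stub_thetaSpan`);
* LEVEL-ONE pieces (types `{(n+1,n-1),(n,n),(n-1,n+1)}`, balanced, not Tate = the `Ψ₃`-CORES with consecutive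
  coordinates at every conjugate) admit a LEFSCHETZ TRANSPORTER ONE RANK DOWN: an Ichino–Prasanna-type morphism of
  Hodge structures `N → H²(S)(1-n)`, `S` a compact Picard modular surface, injective modulo the span and landing in
  the transcendental part `NS(S)^⊥` (Blasius–Rogawski: `NS(S)_ℚ ∩ N'(π'_f) = 0` for stable cuspidal `Ψ₃`) —
  THE LEVER (`stub_transporter`); downstairs, Lefschetz `(1,1)` + Hodge index kill every rational `(1,1)`-class
  orthogonal to `NS(S)` (`stub_downstairs`), so the piece's Hodge classes are confined to the span
  (`transportOfVanishing`, proved);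
* every other piece (killed pieces — no rational Hodge class by the conjugate-dimension sieve — and the residual
  cores `Ψ₅`, `Ψ₄ ∋ 0`, `Ψ₂ ∋ 0`, non-consecutive `Ψ₃`) is the honest uncovered residue (`stub_residual`).
`MiddleThetaSpan_of` assembles this, sorry-free, and concludes the crux BY NAME.

## Why the file builds Hecke operators (typing note — read before attacking a stub)

The lever is a statement about HECKE pieces: in pure Hodge-structure language "a core carries no Hodge class"
is either tautological or the crux itself (Tate summands split off in a polarisable Hodge structure), and an
abstract "Hecke package" hypothesis structure could be inhabited by Hodge-structure projectors isolating Tate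
parts, which would silently turn `stub_thetaSpan` into the crux (costume). The tree has no Hecke action on
`complexBetti` of a ball quotient (HeckeIsotypicComponent.lean: "filed separately"). So this file PINS the
operators to the datum: `T_{ΓgΓ}` (`g ∈ U(V)(F)`, the commensurator) is characterised by its defining identity
pulled back to the finite covers `Γ' \ 𝔹` — built here as `Quot` of the negative cone of `D` with the maps
`[v] ↦ unif (gⱼ v)` (`Cover`, `coverMap`, `pull`, all PROVED well defined and continuous) —
`q^* (T_g x) = Σⱼ mⱼ^* x` for every set of coset representatives (`IsHeckeOperatorAt`, the classical
`(T_g f)(v) = Σⱼ f(gⱼ v)`), plus rationality and Hodge-type stability (`IsHeckeFamily`). This determines `T`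
uniquely (pull-back to a finite Galois cover is injective with `ℂ`-coefficients: tree
`FiniteDeckCover.card_smul_eq_zero_of_map_eq_zero`, `transferMap_map`, once `coverMap Γ' 1` is identified with the orbit
map of the free `Γ/Γ'`-action — the same transfer constructs `T` in Stub 1, cf. the sibling line's `HeckeDatum`); the `ℚ`-algebra generated by the
`T_g` is the inductive predicate `InHeckeAlgebra`, and `IsIsotypicIdempotents` singles out ITS central primitive
idempotents (unique up to relabelling). Hence every `∀ T e A`-quantified stub below is, on paper, a statement
about THE Hecke decomposition of `H^{2n}(X(ℂ))` and THE Hodge decomposition; no fake instance can discharge the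
pin (it is a `∀` over coset data, never vacuously provable). Existence of `T` and of `e` are Stubs 1–2 (genuine
constructions: transfer for finite covers; finite-dimensionality of the Hecke image).

## Stubs (6) and glue
* `stub_heckeOperators` (L, construction) · `stub_matsushima` (M/L, finite-dimensional algebra) ·
  `stub_thetaSpan` (XL, theta half — territory of `definite-twin-theta` ∘ `conjugate-dimension-sieve`) ·
  `stub_transporter` (XL, THE LEVER, hardest) · `stub_downstairs` (M, classical) · `stub_residual` (open residue).
* Glue (sorry-free): `act_*`, `coverMapFun` well-definedness, `continuous_coverMapFun`, `transportOfVanishing`,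
  `MiddleThetaSpan_of`.

## Disproof.lean obligations honoured
`payload.disproof_path` (run/sessions/refuter-cdisprove-stmt-HodgeConjecture-13661-0/folder/Disproof.lean) does
not exist on this hub, the crux directory has no `Disproof.lean` (`ledger crux ls`), `Theorems/MiddleThetaSpan/
Negative/` does not exist, and `ledger negatives --problem HodgeConjecture` lists nothing bearing on ball
quotients: no `_false_without_` theorem or landed Negative lemma constrains the stubs. The refuter's recorded
hypothesis-necessity fact (dropping `IsRationalClass` makes the crux presumably false — Blasius–Rogawski stable
pieces) is honoured visibly: rationality is consumed by `IsIsotypicIdempotents.rational` (components of a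
rational class are rational), by the label `TateShaped` (span of RATIONAL Hodge classes) and by
`IsTransporter.rational` feeding `stub_downstairs`. The per-level caveat R1 (CAVEAT-13661) lives inside
`stub_thetaSpan`. No stub restates the crux, the target `MiddleDegreeStep`, `BallQuotientHodgeAbsolute`, the
summit, or a statement of the negatives index.
-/


noncomputable section

open scoped BigOperators ComplexOrder
open Matrix

set_option linter.dupNamespace false

namespace Summit.HodgeConjecture.HodgeConjecture.Cruxes.MiddleThetaSpan.LefschetzOneRankDown

open Literature.AlgebraicGeometry.Motives (SchemeOver ComplexPoints IsSmoothProjective)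
open Literature.AlgebraicGeometry.HodgeTheory
open Literature.AlgebraicGeometry.ShimuraVarieties
open Literature.AlgebraicTopology.SingularHomology

section Covers

variable {p : ℕ} {X : SchemeOver ℂ} (D : UnitaryBallQuotientDatum p X)

/-- Isometries of `V` preserve the negative cone (cf. `UnitaryBallQuotientDatum.act_mem_cone`, stated
there for `γ ∈ Γ` only). -/
theorem act_mem_cone_of_mem_unitaryGroup {g : GL (Fin (p + 1)) D.E}
    (hg : g ∈ unitaryGroup (conjRingHom D.E) D.H) {v : Fin (p + 1) → ℂ} (hv : v ∈ D.cone) :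
    D.act g v ∈ D.cone := by
  have hu := D.conjTranspose_mul_Hℂ_mul hg
  change (star ((((g : Matrix (Fin (p + 1)) (Fin (p + 1)) D.E)).map D.τ₁) *ᵥ v) ⬝ᵥ
    (D.Hℂ *ᵥ ((((g : Matrix (Fin (p + 1)) (Fin (p + 1)) D.E)).map D.τ₁) *ᵥ v))).re < 0
  rw [star_mulVec, mulVec_mulVec, dotProduct_mulVec, vecMul_vecMul, ← Matrix.mul_assoc, hu,
    ← dotProduct_mulVec]
  exact hv

theorem act_mul (a b : GL (Fin (p + 1)) D.E) (v : Fin (p + 1) → ℂ) :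
    D.act (a * b) v = D.act a (D.act b v) := by
  simp only [UnitaryBallQuotientDatum.act, Units.val_mul, Matrix.map_mul, Matrix.mulVec_mulVec]

theorem act_smul (a : GL (Fin (p + 1)) D.E) (c : ℂ) (v : Fin (p + 1) → ℂ) :
    D.act a (c • v) = c • D.act a v :=
  Matrix.mulVec_smul _ _ _

/-- The orbit relation of `Γ'·ℂˣ` on the negative cone, for a subgroup `Γ' ≤ GL(V)`. -/
def coverRel (Γ' : Subgroup (GL (Fin (p + 1)) D.E)) (v w : D.cone) : Prop :=
  ∃ γ ∈ Γ', ∃ c : ℂ, c ≠ 0 ∧ D.act γ v = c • (w : Fin (p + 1) → ℂ)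

/-- The topological space `Γ' \ 𝔹` (as a `Quot` of the negative cone; for `Γ' ≤ Γ` torsion free of finite
index this is a finite étale cover of `X(ℂ) = Γ \ 𝔹`). -/
def Cover (Γ' : Subgroup (GL (Fin (p + 1)) D.E)) : Type :=
  Quot (coverRel D Γ')

instance (Γ' : Subgroup (GL (Fin (p + 1)) D.E)) : TopologicalSpace (Cover D Γ') :=
  inferInstanceAs (TopologicalSpace (Quot (coverRel D Γ')))

/-- `[v] ↦ unif (g • v) : Γ' \ 𝔹 → X(ℂ)`, well defined when `g Γ' g⁻¹ ≤ Γ` (for `g = 1` the covering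
projection, for `g` a Hecke representative the translated projection). -/
def coverMapFun (Γ' : Subgroup (GL (Fin (p + 1)) D.E)) (g : GL (Fin (p + 1)) D.E)
    (hg : g ∈ unitaryGroup (conjRingHom D.E) D.H) (hΓ : ∀ γ ∈ Γ', g * γ * g⁻¹ ∈ D.Γ) :
    Cover D Γ' → ComplexPoints X :=
  Quot.lift (fun v : D.cone => D.unif (D.act g v)) (by
    rintro v w ⟨γ, hγ, c, hc, hvw⟩
    have hgv : D.act g v ∈ D.cone := act_mem_cone_of_mem_unitaryGroup D hg v.2
    have hgw : D.act g w ∈ D.cone := act_mem_cone_of_mem_unitaryGroup D hg w.2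
    refine (D.unif_eq_unif_iff _ hgv _ hgw).2 ⟨g * γ * g⁻¹, hΓ γ hγ, c, hc, ?_⟩
    change D.act (g * γ * g⁻¹) (D.act g v) = c • D.act g w
    rw [← act_mul D, inv_mul_cancel_right, act_mul D, hvw, act_smul D])

theorem continuous_coverMapFun (Γ' : Subgroup (GL (Fin (p + 1)) D.E)) (g : GL (Fin (p + 1)) D.E)
    (hg : g ∈ unitaryGroup (conjRingHom D.E) D.H) (hΓ : ∀ γ ∈ Γ', g * γ * g⁻¹ ∈ D.Γ) :
    Continuous (coverMapFun D Γ' g hg hΓ) :=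
  continuous_quot_lift _ (D.continuousOn_unif.comp_continuous
    (continuous_const.matrix_mulVec continuous_subtype_val)
    fun v => act_mem_cone_of_mem_unitaryGroup D hg v.2)

/-- The continuous map `[v] ↦ unif (g • v)`. -/
def coverMap (Γ' : Subgroup (GL (Fin (p + 1)) D.E)) (g : GL (Fin (p + 1)) D.E)
    (hg : g ∈ unitaryGroup (conjRingHom D.E) D.H) (hΓ : ∀ γ ∈ Γ', g * γ * g⁻¹ ∈ D.Γ) :
    C(Cover D Γ', ComplexPoints X) :=
  ⟨coverMapFun D Γ' g hg hΓ, continuous_coverMapFun D Γ' g hg hΓ⟩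

/-- Pull-back `Hᵏ(X(ℂ); ℂ) ⟶ Hᵏ(Γ' \ 𝔹; ℂ)` along `[v] ↦ unif (g • v)`. -/
def pull (k : ℕ) (Γ' : Subgroup (GL (Fin (p + 1)) D.E)) (g : GL (Fin (p + 1)) D.E)
    (hg : g ∈ unitaryGroup (conjRingHom D.E) D.H) (hΓ : ∀ γ ∈ Γ', g * γ * g⁻¹ ∈ D.Γ) :
    complexBetti X k ⟶ singularCohomology ℂ ℂ (Cover D Γ') k :=
  singularCohomology.map ℂ ℂ (coverMap D Γ' g hg hΓ) k

/-- `reps` is a set of representatives of the left `Γ`-cosets in the double coset `Γ g Γ`, and the finite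
cover `Γ' \ 𝔹` is deep enough to see all the translates `[v] ↦ unif (gⱼ • v)`. -/
structure IsHeckeReps (Γ' : Subgroup (GL (Fin (p + 1)) D.E)) (g : GL (Fin (p + 1)) D.E)
    (reps : Finset (GL (Fin (p + 1)) D.E)) : Prop where
  le : Γ' ≤ D.Γ
  finiteIndex : (Γ'.subgroupOf D.Γ).FiniteIndex
  mem_unitaryGroup : ∀ j ∈ reps, j ∈ unitaryGroup (conjRingHom D.E) D.H
  mem_doset : ∀ j ∈ reps, ∃ γ₁ ∈ D.Γ, ∃ γ₂ ∈ D.Γ, j = γ₁ * g * γ₂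
  cosets : ∀ γ₁ ∈ D.Γ, ∀ γ₂ ∈ D.Γ, ∃! j, j ∈ reps ∧ ∃ γ ∈ D.Γ, γ₁ * g * γ₂ = γ * j
  normal : ∀ j ∈ reps, ∀ γ ∈ Γ', j * γ * j⁻¹ ∈ D.Γ

theorem IsHeckeReps.one_normal {Γ' : Subgroup (GL (Fin (p + 1)) D.E)} {g : GL (Fin (p + 1)) D.E}
    {reps : Finset (GL (Fin (p + 1)) D.E)} (h : IsHeckeReps D Γ' g reps) :
    ∀ γ ∈ Γ', (1 : GL (Fin (p + 1)) D.E) * γ * 1⁻¹ ∈ D.Γ := by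
  intro γ hγ
  simpa using h.le hγ

/-- THE PIN. `Tg` is the Hecke operator of the double coset `Γ g Γ` on `Hᵏ(X(ℂ); ℂ)`: for every finite
cover `q : Γ' \ 𝔹 → X(ℂ)` deep enough and every set of coset representatives `Γ g Γ = ⊔ⱼ Γ gⱼ`,
`q^* (Tg x) = Σⱼ mⱼ^* x` with `mⱼ [v] = unif (gⱼ • v)` (the classical `(T_g f)(v) = Σⱼ f(gⱼ v)`). -/
def IsHeckeOperatorAt (k : ℕ) (g : GL (Fin (p + 1)) D.E)
    (Tg : complexBetti X k →ₗ[ℂ] complexBetti X k) : Prop :=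
  ∀ (Γ' : Subgroup (GL (Fin (p + 1)) D.E)) (reps : Finset (GL (Fin (p + 1)) D.E))
    (h : IsHeckeReps D Γ' g reps) (x : complexBetti X k),
    pull D k Γ' 1 (one_mem _) h.one_normal (Tg x) =
      ∑ j ∈ reps.attach, pull D k Γ' j (h.mem_unitaryGroup j j.2) (h.normal j j.2) x

end Covers

/-! ### Hecke families, the `ℚ`-algebra they generate, isotypic idempotents -/

section Hecke

variable {p : ℕ} {X : SchemeOver ℂ} (D : UnitaryBallQuotientDatum p X)

/-- The `(a,b)`-type subspace of `Hᵏ(X(ℂ); ℂ)` cut out by a Hodge model `A` (pull-back of `A.hodgePQ`). -/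
def typePart (A : HodgeModel p X) (k a b : ℕ) : Submodule ℂ (complexBetti X k) :=
  (A.hodgePQ k a b).comap (A.pullback k).hom

theorem mem_typePart_iff (A : HodgeModel p X) (k a b : ℕ) (x : complexBetti X k) :
    x ∈ typePart A k a b ↔ A.pullback k x ∈ A.hodgePQ k a b :=
  Iff.rfl

/-- `T` is THE family of Hecke operators `g ↦ T_{ΓgΓ}` on `Hᵏ(X(ℂ); ℂ)`, `g ∈ U(V)(F)`: pinned by the
pull-back identity `IsHeckeOperatorAt` (unique on paper: pull-back to a finite cover is injective with
`ℂ`-coefficients), defined over `ℚ` (finite correspondences preserve `Hᵏ(X(ℂ); ℚ)`) and respecting every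
Hodge type (Hecke correspondences are algebraic: morphisms of Hodge structures, BMM Thm 61). -/
structure IsHeckeFamily (k : ℕ)
    (T : GL (Fin (p + 1)) D.E → (complexBetti X k →ₗ[ℂ] complexBetti X k)) : Prop where
  isHecke : ∀ g ∈ unitaryGroup (conjRingHom D.E) D.H, IsHeckeOperatorAt D k g (T g)
  rational : ∀ g ∈ unitaryGroup (conjRingHom D.E) D.H, ∀ x : complexBetti X k,
    IsRationalClass x → IsRationalClass (T g x)
  hodgeType : ∀ g ∈ unitaryGroup (conjRingHom D.E) D.H, ∀ (A : HodgeModel p X) (a b : ℕ),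
    ∀ x ∈ typePart A k a b, T g x ∈ typePart A k a b

/-- Membership in the `ℚ`-subalgebra of `End_ℂ Hᵏ(X(ℂ); ℂ)` generated by the Hecke operators (the
image of the rational Hecke algebra `ℋ(U(V)(F), Γ) ⊗ ℚ`), as an inductive predicate. -/
inductive InHeckeAlgebra (k : ℕ) (T : GL (Fin (p + 1)) D.E → (complexBetti X k →ₗ[ℂ] complexBetti X k)) :
    (complexBetti X k →ₗ[ℂ] complexBetti X k) → Prop
  | gen {g : GL (Fin (p + 1)) D.E} (hg : g ∈ unitaryGroup (conjRingHom D.E) D.H) : InHeckeAlgebra k T (T g)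
  | one : InHeckeAlgebra k T LinearMap.id
  | add {f f' : complexBetti X k →ₗ[ℂ] complexBetti X k} :
      InHeckeAlgebra k T f → InHeckeAlgebra k T f' → InHeckeAlgebra k T (f + f')
  | comp {f f' : complexBetti X k →ₗ[ℂ] complexBetti X k} :
      InHeckeAlgebra k T f → InHeckeAlgebra k T f' → InHeckeAlgebra k T (f ∘ₗ f')
  | smul (q : ℚ) {f : complexBetti X k →ₗ[ℂ] complexBetti X k} :
      InHeckeAlgebra k T f → InHeckeAlgebra k T ((q : ℂ) • f)

/-- `e` is THE family of central primitive idempotents of the rational Hecke algebra acting on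
`Hᵏ(X(ℂ); ℂ)` (unique up to relabelling): the projectors onto the `ℚ`-Hecke-isotypic pieces
`W([π_f])^Γ ⊗ ℂ = ⊕_σ H^k(σπ_f) ⊗ σπ_f^Γ` of Matsushima's decomposition (BMM §1.8–1.9, Thm 61). The last two
clauses (rationality, Hodge types) are consequences of `mem` and `IsHeckeFamily`, recorded for the glue. -/
structure IsIsotypicIdempotents (k : ℕ)
    (T : GL (Fin (p + 1)) D.E → (complexBetti X k →ₗ[ℂ] complexBetti X k))
    {ι : Type} [Fintype ι] (e : ι → (complexBetti X k →ₗ[ℂ] complexBetti X k)) : Prop where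
  mem : ∀ i, InHeckeAlgebra D k T (e i)
  idem : ∀ i, e i ∘ₗ e i = e i
  ortho : ∀ i j, i ≠ j → e i ∘ₗ e j = 0
  sum : ∑ i, e i = LinearMap.id
  central : ∀ i, ∀ g ∈ unitaryGroup (conjRingHom D.E) D.H, e i ∘ₗ T g = T g ∘ₗ e i
  primitive : ∀ i (f : complexBetti X k →ₗ[ℂ] complexBetti X k), InHeckeAlgebra D k T f →
    (∀ g ∈ unitaryGroup (conjRingHom D.E) D.H, f ∘ₗ T g = T g ∘ₗ f) → f ∘ₗ f = f →
    f ∘ₗ e i = 0 ∨ f ∘ₗ e i = e i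
  rational : ∀ i (x : complexBetti X k), IsRationalClass x → IsRationalClass (e i x)
  hodgeType : ∀ i (A : HodgeModel p X) (a b : ℕ), ∀ x ∈ typePart A k a b, e i x ∈ typePart A k a b

end Hecke

/-! ### The crux: the theta span, Hodge-number labels of isotypic pieces, Lefschetz transporters -/

section Crux

/-- The span of the crux `MiddleThetaSpan` (copied verbatim): `SC^{m+1}(D) ⊔ SC^m(D)·Alg¹ ⊔ Hdg^{m,m}·Alg¹`. -/
def thetaSpan (m : ℕ) (X : SchemeOver ℂ) (D : UnitaryBallQuotientDatum (2 * (m + 1)) X) :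
    Submodule ℂ (complexBetti X (2 * (m + 1))) :=
  (⨆ (W : Submodule D.E (Fin (2 * (m + 1) + 1) → D.E))
      (_ : IsTotallyPositive (conjRingHom D.E) D.H W) (_ : Module.finrank D.E W = m + 1),
      classesSupportedOn X (D.specialSubvariety W) (2 * (m + 1))) ⊔
    Submodule.span ℂ {z : complexBetti X (2 * (m + 1)) |
      ∃ s ∈ (⨆ (W : Submodule D.E (Fin (2 * (m + 1) + 1) → D.E))
        (_ : IsTotallyPositive (conjRingHom D.E) D.H W) (_ : Module.finrank D.E W = m),
        classesSupportedOn X (D.specialSubvariety W) (2 * m)),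
      ∃ d ∈ algebraicClasses X 1, z = cupProduct (two_mul_add_two_mul m 1) s d} ⊔
    Submodule.span ℂ {z : complexBetti X (2 * (m + 1)) | ∃ a : complexBetti X (2 * m),
      IsRationalClass a ∧ IsOfHodgeType (2 * (m + 1)) X (2 * m) m m a ∧
      ∃ d ∈ algebraicClasses X 1, z = cupProduct (two_mul_add_two_mul m 1) a d}

/-- Sanity: the crux is literally "every rational Hodge `(m+1,m+1)`-class lies in `thetaSpan`". -/
example : Summit.HodgeConjecture.HodgeConjecture.Theses.EndoscopicMiddleDegree.MiddleThetaSpan ↔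
    ∀ (m : ℕ) (X : SchemeOver ℂ) (D : UnitaryBallQuotientDatum (2 * (m + 1)) X), 1 ≤ m → m ≤ 2 →
      ∀ c : complexBetti X (2 * (m + 1)), IsRationalClass c →
        IsOfHodgeType (2 * (m + 1)) X (2 * (m + 1)) (m + 1) (m + 1) c → c ∈ thetaSpan m X D :=
  Iff.rfl

variable (m : ℕ) {X : SchemeOver ℂ}

/-- The `ℂ`-span of the rational Hodge `(m+1,m+1)`-classes (Hodge classes w.r.t. the model `A`). -/
def hdgClasses (A : HodgeModel (2 * (m + 1)) X) : Submodule ℂ (complexBetti X (2 * (m + 1))) :=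
  Submodule.span ℂ {x | IsRationalClass x ∧ x ∈ typePart A (2 * (m + 1)) (m + 1) (m + 1)}

/-- LABEL "Tate-shaped": the piece consists of Hodge classes (for a genuine `ℚ`-Hecke piece `N(π_f)`:
`Σ(σπ_f) = {A(n,n)}` for every `σ` — the Tate-type SINGLETON pieces of the sieve, the theta half's domain). -/
def TateShaped (A : HodgeModel (2 * (m + 1)) X) (N : Submodule ℂ (complexBetti X (2 * (m + 1)))) : Prop :=
  N ≤ hdgClasses m A

/-- LABEL "level one": Hodge types within `{(n+1,n-1),(n,n),(n-1,n+1)}` (`n = m+1`), BALANCED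
(`h^{n+1,n-1} = h^{n,n}`) and not Tate-shaped — for a genuine piece: a `Ψ₃`-core with consecutive
`τ₁`-coordinates at every conjugate (types `{(3,1),(2,2),(1,3)}` for `m = 1`), the scope of this line. -/
def LevelOne (A : HodgeModel (2 * (m + 1)) X) (N : Submodule ℂ (complexBetti X (2 * (m + 1)))) : Prop :=
  N ≤ typePart A (2 * (m + 1)) (m + 2) m ⊔ typePart A (2 * (m + 1)) (m + 1) (m + 1) ⊔
      typePart A (2 * (m + 1)) m (m + 2) ∧
    Module.finrank ℂ ↥(N ⊓ typePart A (2 * (m + 1)) (m + 2) m) =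
      Module.finrank ℂ ↥(N ⊓ typePart A (2 * (m + 1)) (m + 1) (m + 1)) ∧
    ¬ TateShaped m A N

variable (X) in
/-- A LEFSCHETZ TRANSPORTER for `N` ("one rank down"): a smooth projective surface `S` and a `ℂ`-linear
`φ : H^{2n}(X(ℂ); ℂ) → H²(S(ℂ); ℂ)` which on `N` is a morphism of `ℚ`-Hodge structures twisted by `(n-1)`
(rational to rational, type `(n+1-j, n-1+j) ↦ (2-j, j)`), lands in the TRANSCENDENTAL part (cup-orthogonal
to every divisor class of `S`), and whose kernel on `N` is confined to the theta span. Intended: `S` a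
compact Picard modular surface for `U(W₃)/E`, `φ` the Ichino–Prasanna-type theta transporter onto
`N'(π'_f)(-1)`, `π'_f` in the stable `Ψ₃`-packet; `NS(S)_ℚ ∩ N' = 0` by Blasius–Rogawski. -/
structure IsTransporter (D : UnitaryBallQuotientDatum (2 * (m + 1)) X) (A : HodgeModel (2 * (m + 1)) X)
    (N : Submodule ℂ (complexBetti X (2 * (m + 1)))) (S : SchemeOver ℂ)
    (φ : complexBetti X (2 * (m + 1)) →ₗ[ℂ] complexBetti S (2 * 1)) : Prop where
  smooth : IsSmoothProjective 2 S
  rational : ∀ x ∈ N, IsRationalClass x → IsRationalClass (φ x)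
  type20 : ∀ x ∈ N, x ∈ typePart A (2 * (m + 1)) (m + 2) m → IsOfHodgeType 2 S (2 * 1) 2 0 (φ x)
  type11 : ∀ x ∈ N, x ∈ typePart A (2 * (m + 1)) (m + 1) (m + 1) → IsOfHodgeType 2 S (2 * 1) 1 1 (φ x)
  type02 : ∀ x ∈ N, x ∈ typePart A (2 * (m + 1)) m (m + 2) → IsOfHodgeType 2 S (2 * 1) 0 2 (φ x)
  perp : ∀ x ∈ N, ∀ d ∈ algebraicClasses S 1, cupProduct (two_mul_add_two_mul 1 1) (φ x) d = 0
  ker : ∀ x ∈ N, φ x = 0 → x ∈ thetaSpan m X D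

end Crux

/-! ### The six registered stubs -/

/-- **Stub 1 — the Hecke operators exist (L; construction).** For every datum and degree there is a family
`T` satisfying the pin: transfer (`π_{1*}`) for the finite covers `Γ' \ 𝔹 → X(ℂ)` on singular
cohomology, `T_{ΓgΓ} = Σⱼ gⱼ^*` on `Γ'`-level classes; defined over `ℚ`; a morphism of Hodge structures
(Hecke correspondences are finite algebraic correspondences; BMM arXiv:1306.1515 Part 2 §1.8–1.9, Thm 61). -/
theorem stub_heckeOperators : ∀ (p k : ℕ) (X : SchemeOver ℂ) (D : UnitaryBallQuotientDatum p X),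
    ∃ T : GL (Fin (p + 1)) D.E → (complexBetti X k →ₗ[ℂ] complexBetti X k), IsHeckeFamily D k T := by
  sorry

/-- **Stub 2 — Matsushima idempotents (M/L; finite-dimensional algebra).** The `ℚ`-algebra generated by a
Hecke family is finite dimensional (it acts faithfully on the finite-dimensional `ℚ`-space `Hᵏ(X(ℂ); ℚ)`,
`X(ℂ)` a compact manifold); its central primitive idempotents sum to `1`, lie in the algebra (hence are
rational and respect Hodge types) — the projectors onto the `ℚ`-isotypic pieces `W([π_f])^Γ ⊗ ℂ`
(BMM Thm 61; Borel–Wallach VII for Matsushima's formula identifying the pieces). -/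
theorem stub_matsushima : ∀ (p k : ℕ) (X : SchemeOver ℂ) (D : UnitaryBallQuotientDatum p X)
    (T : GL (Fin (p + 1)) D.E → (complexBetti X k →ₗ[ℂ] complexBetti X k)), IsHeckeFamily D k T →
    ∃ (ι : Type) (_ : Fintype ι) (e : ι → (complexBetti X k →ₗ[ℂ] complexBetti X k)),
      IsIsotypicIdempotents D k T e := by
  sorry

/-- **Stub 3 — the theta half (XL; sibling lines `definite-twin-theta` ∘ `conjugate-dimension-sieve`).**
A `ℚ`-Hecke-isotypic piece of `H^{2n}` consisting of Hodge classes — i.e. `Σ(σπ_f) = {A(n,n)}` for all `σ`,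
a Tate-type singleton piece (`χ₀` of parallel weight) — lies in the theta span: the packet is
`Ψ' ⊞ χ₀`, `π` is a theta lift from a coherent `U(n,n)` carrying the Kudla–Millson class (a = 1 case of
BMM Thm 72 via the definite twin / Rallis–Yamana first-term range), and BMM Thm 69/71 put `M[π_f]` into
`SC^n ⊔ SC^{n-1}·Alg¹ ⊔` Lefschetz (per-level caveat R1 of the refuter included). -/
theorem stub_thetaSpan : ∀ (m : ℕ) (X : SchemeOver ℂ) (D : UnitaryBallQuotientDatum (2 * (m + 1)) X),
    1 ≤ m → m ≤ 2 →
    ∀ (T : GL (Fin (2 * (m + 1) + 1)) D.E → (complexBetti X (2 * (m + 1)) →ₗ[ℂ] complexBetti X (2 * (m + 1)))),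
    IsHeckeFamily D (2 * (m + 1)) T →
    ∀ (ι : Type) [Fintype ι] (e : ι → (complexBetti X (2 * (m + 1)) →ₗ[ℂ] complexBetti X (2 * (m + 1)))),
    IsIsotypicIdempotents D (2 * (m + 1)) T e →
    ∀ (A : HodgeModel (2 * (m + 1)) X) (i : ι), TateShaped m A (LinearMap.range (e i)) →
      LinearMap.range (e i) ≤ thetaSpan m X D := by
  sorry

/-- **Stub 4 — THE LEVER: level-one pieces are Lefschetz-transportable (XL).** A `ℚ`-Hecke-isotypic piece
of `H^{2n}(X(ℂ))` with Hodge types `{(n+1,n-1),(n,n),(n-1,n+1)}`, balanced and not Tate-shaped (for a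
genuine piece: a `Ψ₃`-core, `Ψ₃` cuspidal with consecutive coordinates at every conjugate) admits a
transporter `IsTransporter`: Ichino–Prasanna mechanism (arXiv:1806.10563 Thm 1, §1.2 (iii)–(vii): a
theta-built class on an auxiliary unitary Shimura variety, Hodge by PACKET PURITY, both seesaw periods
non-zero `⇒` injective on `N(π_f)` — available for the `3+1+1` shapes `Ψ₃ ⊞ χ ⊞ χ'` via `U(W₄)`; for `3+2`
the statement is the Tate/Hodge prediction without engine), target a compact Picard modular surface `S`
for `U(W₃)/E`, image `N'(π'_f)(-1)` with `NS(S)_ℚ ∩ N' = 0` (divisor classes are Galois invariant,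
`r(Ψ₃)(1)` irreducible: Blasius–Rogawski zbl:0828.14012; Galois action Kisin–Shin–Zhu arXiv:2110.05381),
whence the image is cup-orthogonal to `NS(S)` (Hecke-orthogonality). If the piece carried a rational
Hodge class outside the span, `ker` + `stub_downstairs` would be contradicted: the stub EMBODIES
CoreVanishing for `Ψ₃`-cores. -/
theorem stub_transporter : ∀ (m : ℕ) (X : SchemeOver ℂ) (D : UnitaryBallQuotientDatum (2 * (m + 1)) X),
    1 ≤ m → m ≤ 2 →
    ∀ (T : GL (Fin (2 * (m + 1) + 1)) D.E → (complexBetti X (2 * (m + 1)) →ₗ[ℂ] complexBetti X (2 * (m + 1)))),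
    IsHeckeFamily D (2 * (m + 1)) T →
    ∀ (ι : Type) [Fintype ι] (e : ι → (complexBetti X (2 * (m + 1)) →ₗ[ℂ] complexBetti X (2 * (m + 1)))),
    IsIsotypicIdempotents D (2 * (m + 1)) T e →
    ∀ (A : HodgeModel (2 * (m + 1)) X) (i : ι), LevelOne m A (LinearMap.range (e i)) →
      ∃ (S : SchemeOver ℂ) (φ : complexBetti X (2 * (m + 1)) →ₗ[ℂ] complexBetti S (2 * 1)),
        IsTransporter m X D A (LinearMap.range (e i)) S φ := by
  sorry

/-- **Stub 5 — downstairs, one rank down (M; classical).** On a smooth projective surface a rational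
`(1,1)`-class cup-orthogonal to every divisor class vanishes: it is a divisor class by Lefschetz `(1,1)`
(`lefschetzOneOne_rational`, Voisin I Thm 11.30) and the intersection form on `NS(S)_ℚ` is non-degenerate
(Hodge index theorem, Hartshorne V.1.9 / Voisin I 6.3.3; file `HodgeIndexSurface`). -/
theorem stub_downstairs : ∀ (S : SchemeOver ℂ), IsSmoothProjective 2 S →
    ∀ c : complexBetti S (2 * 1), IsRationalClass c → IsOfHodgeType 2 S (2 * 1) 1 1 c →
      (∀ d ∈ algebraicClasses S 1, cupProduct (two_mul_add_two_mul 1 1) c d = 0) → c = 0 := by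
  sorry

/-- **Stub 6 — the residue (open problem; honest uncovered part).** In a `ℚ`-Hecke-isotypic piece that is
neither Tate-shaped nor level one, every rational Hodge `(n,n)`-class lies in the theta span. Genuine such
pieces: KILLED pieces (singleton `Σ(σπ_f)` whose slot leaves the centre at some conjugate — NO rational
Hodge class by the conjugate-dimension sieve, provable from `T_λ`-freeness), and the RESIDUAL CORES
(`Ψ₅` stable, `Ψ₄ ∋ 0`, `Ψ₂ ∋ 0`, non-consecutive `Ψ₃`: CoreVanishing expected, tool-less today — the
triage's uncovered residue, each refutable by ONE rational class in ONE such piece). -/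
theorem stub_residual : ∀ (m : ℕ) (X : SchemeOver ℂ) (D : UnitaryBallQuotientDatum (2 * (m + 1)) X),
    1 ≤ m → m ≤ 2 →
    ∀ (T : GL (Fin (2 * (m + 1) + 1)) D.E → (complexBetti X (2 * (m + 1)) →ₗ[ℂ] complexBetti X (2 * (m + 1)))),
    IsHeckeFamily D (2 * (m + 1)) T →
    ∀ (ι : Type) [Fintype ι] (e : ι → (complexBetti X (2 * (m + 1)) →ₗ[ℂ] complexBetti X (2 * (m + 1)))),
    IsIsotypicIdempotents D (2 * (m + 1)) T e →
    ∀ (A : HodgeModel (2 * (m + 1)) X) (i : ι), ¬ TateShaped m A (LinearMap.range (e i)) →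
      ¬ LevelOne m A (LinearMap.range (e i)) →
      ∀ x ∈ LinearMap.range (e i), IsRationalClass x →
        x ∈ typePart A (2 * (m + 1)) (m + 1) (m + 1) → x ∈ thetaSpan m X D := by
  sorry

/-! ### The composition (sorry-free): `MiddleThetaSpan` from the six stubs -/

/-- TRANSPORT OF VANISHING (the idea's first lemma, here in its used form): a transporter plus the
downstairs lemma confine the rational Hodge classes of a level-one piece to the theta span. -/
theorem transportOfVanishing {m : ℕ} {X : SchemeOver ℂ} {D : UnitaryBallQuotientDatum (2 * (m + 1)) X}
    {A : HodgeModel (2 * (m + 1)) X} {N : Submodule ℂ (complexBetti X (2 * (m + 1)))} {S : SchemeOver ℂ}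
    {φ : complexBetti X (2 * (m + 1)) →ₗ[ℂ] complexBetti S (2 * 1)} (hφ : IsTransporter m X D A N S φ)
    (hdown : ∀ c : complexBetti S (2 * 1), IsRationalClass c → IsOfHodgeType 2 S (2 * 1) 1 1 c →
      (∀ d ∈ algebraicClasses S 1, cupProduct (two_mul_add_two_mul 1 1) c d = 0) → c = 0)
    {x : complexBetti X (2 * (m + 1))} (hx : x ∈ N) (hrat : IsRationalClass x)
    (htyp : x ∈ typePart A (2 * (m + 1)) (m + 1) (m + 1)) : x ∈ thetaSpan m X D :=
  hφ.ker x hx (hdown (φ x) (hφ.rational x hx hrat) (hφ.type11 x hx htyp)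
    fun d hd => hφ.perp x hx d hd)

/-- **`MiddleThetaSpan` from the stubs.** Take the Hecke operators (Stub 1) and their isotypic idempotents
(Stub 2); a rational Hodge class `c` (of type `(n,n)` in a model `A`) is the sum of its components `eᵢ c`,
each again rational of type `(n,n)` and lying in the piece `range eᵢ`; a Tate-shaped piece is in the span
(Stub 3), a level-one piece is transported and its Hodge classes are confined by the downstairs lemma
(Stubs 4, 5, `transportOfVanishing`), any other piece is the residue (Stub 6); the span is a submodule. -/
theorem MiddleThetaSpan_of :
    Summit.HodgeConjecture.HodgeConjecture.Theses.EndoscopicMiddleDegree.MiddleThetaSpan := by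
  intro m X D hm1 hm2 c hc hh
  change c ∈ thetaSpan m X D
  obtain ⟨A, hA⟩ := hh
  have hcA : c ∈ typePart A (2 * (m + 1)) (m + 1) (m + 1) := hA
  obtain ⟨T, hT⟩ := stub_heckeOperators (2 * (m + 1)) (2 * (m + 1)) X D
  obtain ⟨ι, hι, e, he⟩ := stub_matsushima (2 * (m + 1)) (2 * (m + 1)) X D T hT
  have hsum : (∑ i, e i c) = c := by
    have h := LinearMap.congr_fun he.sum c
    rw [LinearMap.sum_apply] at h
    exact h
  suffices h : (∑ i, e i c) ∈ thetaSpan m X D by rwa [hsum] at h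
  refine Submodule.sum_mem _ fun i _ => ?_
  have hrat : IsRationalClass (e i c) := he.rational i c hc
  have htyp : e i c ∈ typePart A (2 * (m + 1)) (m + 1) (m + 1) := he.hodgeType i A (m + 1) (m + 1) c hcA
  have hmem : e i c ∈ LinearMap.range (e i) := LinearMap.mem_range_self (e i) c
  by_cases h1 : TateShaped m A (LinearMap.range (e i))
  · exact stub_thetaSpan m X D hm1 hm2 T hT ι e he A i h1 hmem
  · by_cases h2 : LevelOne m A (LinearMap.range (e i))
    · obtain ⟨S, φ, hφ⟩ := stub_transporter m X D hm1 hm2 T hT ι e he A i h2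
      exact transportOfVanishing hφ (stub_downstairs S hφ.smooth) hmem hrat htyp
    · exact stub_residual m X D hm1 hm2 T hT ι e he A i h1 h2 _ hmem hrat htyp

end Summit.HodgeConjecture.HodgeConjecture.Cruxes.MiddleThetaSpan.LefschetzOneRankDown

end
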